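import Summits.BirchSwinnertonDyer.BirchSwinnertonDyer.Theorems.SignedLowerHalvesSmallImageLowerHalfBothSignsRttF1CMRealityPrefix
import Literature.NumberTheory.GaloisRepresentations.GrossencharakterSharpModulus
import Literature.NumberTheory.GaloisRepresentations.CMTypeHeckeCharacter
import HarnessLib

/-!
# The SHARP modulus of the theta partner's Grössencharakter has c-STABLE SUPPORT (crux L `SmallImageLowerHalfBothSigns`,
# stmt-BirchSwinnertonDyer-23599, line `rtt_w3`; input of the frame's `c • 𝔣 = 𝔣` for S4‴'s `h𝔣c`)

INPUTS hand `bsd-inputs-honda-p1` g32 under LEAD `cruxlead-stmt-BirchSwinnertonDyer-23599`; helper `--supports stmt-BirchSwinnertonDyer-23599`;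
THEOREMS ONLY, no `sorry`. Closes nothing; BSD / crux L / S4‴ are NOT proved by this.

WHY. The S4‴ closing (`junctionRecipValues_of_F1`, -w3 g30) reindexes Kato's `ψ̄`-series into the Mazur–Tate side's `ψ`-series over the ideals
prime to `p𝔣`; it needs the frame level `𝔣` to be `c`-STABLE (`h𝔣c : cK • 𝔣 = 𝔣`, `c` the nontrivial automorphism of the quadratic `K`).
The frame builds `𝔣` from the conductor support of `θ′` and the Grössencharakter modulus `𝔪`; its `c`-stability therefore rests on the
`c`-stability of `supp 𝔪 = ram ψ̃`. For the SHARP modulus of producer′ (`exists_arithmeticHalf_classwide_sharp`: (prim′) `supp 𝔪 = ram χ` for every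
idelic realisation `χ` of `ψ`) this follows from CM-reality (`SmallImageRttF1Bridge.apply_smul_eq_conj_of_prefix`, honda g31: `ψ(c • w) = ψ̄(w)` at
every prime over `ℓ ∤ |d_K| N𝔪`) by multiplicity one for `GL(1)`: the Galois conjugate `ω ∘ c` (`HeckeCharacter.galConj`) and the complex conjugate
`\bar ω` (`HasInfinityType.autConj` along `conj : ℂ ≃ₐ[ℚ] ℂ`, Weil 1956) of the realisation `ω = heckeOfGross` agree at almost every uniformiser, hence
are EQUAL (`HeckeCharacter.ext_of_eventually_valueAtUniformizer_eq`), so `ram ω` is `c`-stable (`isUnramifiedAt_galConj_iff`,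
`isUnramifiedAt_autConj_iff`).

* ★ `le_smul_asIdeal_iff_of_sharp` — under the v43 prefix binders (`hK2`, totally complex, `σK`, `𝔪 ≠ 0`, `hψ`, `hψpow`) and (prim′):
  `𝔪 ≤ (c • w).asIdeal ↔ 𝔪 ≤ w.asIdeal` for every prime `w` and every `c : K ≃ₐ[ℚ] K` — the premise `hc𝔪` of the frame v7.

References: [Weil1956] §1; [CasselsFrohlichANT1967] Ch. VII §4 Prop. 4.1; [NeukirchANT1999] Ch. VII §6 (6.14).
-/

set_option autoImplicit false
set_option linter.dupNamespace false
noncomputable section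

open scoped NumberField ComplexConjugate Pointwise
open IsDedekindDomain IsDedekindDomain.HeightOneSpectrum NumberField Filter
  Literature.NumberTheory.GaloisRepresentations Literature.NumberTheory.LFunctions
  Literature.NumberTheory.GaloisRepresentations.HeckeCharacter Literature.NumberTheory.Automorphic
  Literature.NumberTheory.EllipticCurves Rat.HeightOneSpectrum
  Summit.BirchSwinnertonDyer.BirchSwinnertonDyer.Theorems.SmallImageRttF1Bridge

namespace Summit.BirchSwinnertonDyer.BirchSwinnertonDyer.Theorems.SmallImageLambdaLowerThreeNsThetaPartner

section Symm

variable {K : Type} [Field K] [NumberField K]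

omit [NumberField K] in
/-- Complex conjugation as a `ℚ`-algebra automorphism of `ℂ`. [folklore] -/
private theorem restrictScalars_conjAe_apply (z : ℂ) : (Complex.conjAe.restrictScalars ℚ) z = conj z := rfl

/-- The primes dividing a non-zero ideal, translated by an automorphism, are still finitely many: `∀ᶠ v, ¬ 𝔪 ≤ (c • v)`. [folklore] -/
private theorem eventually_not_le_smul_asIdeal {𝔪 : Ideal (𝓞 K)} (h𝔪 : 𝔪 ≠ ⊥) (c : K ≃ₐ[ℚ] K) :
    ∀ᶠ v : HeightOneSpectrum (𝓞 K) in cofinite, ¬ 𝔪 ≤ (c • v).asIdeal := by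
  have hfin : {u : HeightOneSpectrum (𝓞 K) | 𝔪 ≤ u.asIdeal}.Finite :=
    (Ideal.finite_factors h𝔪).subset fun u hu => Ideal.dvd_iff_le.mpr hu
  have h2 : {v : HeightOneSpectrum (𝓞 K) | 𝔪 ≤ (c • v).asIdeal} = (fun v => c • v) ⁻¹' {u | 𝔪 ≤ u.asIdeal} := rfl
  refine eventually_cofinite.mpr ?_
  show {v : HeightOneSpectrum (𝓞 K) | ¬¬ 𝔪 ≤ (c • v).asIdeal}.Finite
  simp only [not_not]
  rw [h2]
  exact hfin.preimage (MulAction.injective c).injOn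

/-- Off the primes of `𝔪`: `∀ᶠ v, ¬ 𝔪 ≤ v`. [folklore] -/
private theorem eventually_not_le_asIdeal' {𝔪 : Ideal (𝓞 K)} (h𝔪 : 𝔪 ≠ ⊥) :
    ∀ᶠ v : HeightOneSpectrum (𝓞 K) in cofinite, ¬ 𝔪 ≤ v.asIdeal := by
  simpa only [one_smul] using eventually_not_le_smul_asIdeal h𝔪 (1 : K ≃ₐ[ℚ] K)

/-- CM-reality holds at all but finitely many primes: `ψ(c • w) = \overline{ψ(w)}` off the primes over `|d_K|·N𝔪` (honda g31's
`apply_smul_eq_conj_of_prefix` at every prime over `ℓ ∤ |d_K| N𝔪`). [cite: NeukirchANT1999, Ch. VII §6 Def. (6.1)] -/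
theorem eventually_apply_smul_eq_conj [IsTotallyComplex K] (hK2 : Module.finrank ℚ K = 2) (σK : K →+* ℂ) (c : K ≃ₐ[ℚ] K) (hc : c ≠ 1)
    {𝔪 : Ideal (𝓞 K)} (h𝔪 : 𝔪 ≠ ⊥) {ψ : HeightOneSpectrum (𝓞 K) → ℂ} (hψ : IsGrossencharakter 𝔪 (embType σK) (embTypeConj σK) ψ)
    (hψpow : ∀ n : ℕ, Odd n → n.Coprime ((NumberField.discr K).natAbs * Ideal.absNorm 𝔪) →
      idealPow K ψ (Ideal.span {(n : 𝓞 K)}) = (jacobiSym (NumberField.discr K) n : ℂ) * (n : ℂ) ^ (2 - 1)) :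
    ∀ᶠ w : HeightOneSpectrum (𝓞 K) in cofinite, ψ (c • w) = conj (ψ w) := by
  set D : ℕ := (NumberField.discr K).natAbs * Ideal.absNorm 𝔪 with hD
  have hD0 : (D : 𝓞 K) ≠ 0 := by
    have h1 : (NumberField.discr K).natAbs ≠ 0 := Int.natAbs_ne_zero.mpr (NumberField.discr_ne_zero K)
    have h2 : Ideal.absNorm 𝔪 ≠ 0 := by rw [Ne, Ideal.absNorm_eq_zero_iff]; exact h𝔪
    exact_mod_cast mul_ne_zero h1 h2
  have hsp : Ideal.span {(D : 𝓞 K)} ≠ ⊥ := by rwa [Ne, Ideal.span_singleton_eq_bot]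
  filter_upwards [eventually_not_le_asIdeal' hsp] with w hw
  -- the rational prime under `w` does not divide `D`
  set v := w.under (𝓞 ℚ) with hvdef
  set ℓ : ℕ := (primesEquiv v : ℕ) with hℓdef
  have hℓ : ℓ.Prime := (primesEquiv v).2
  have hℓw : (ℓ : 𝓞 K) ∈ w.asIdeal := (under_eq_iff_natCast_primesEquiv_mem w v).mp rfl
  have hℓD : ¬ ℓ ∣ D := by
    rintro ⟨k, hk⟩
    apply hw
    rw [Ideal.span_singleton_le_iff_mem, hk, Nat.cast_mul]
    exact w.asIdeal.mul_mem_right _ hℓw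
  exact apply_smul_eq_conj_of_prefix hK2 σK c hc h𝔪 hψ hψpow hℓ hℓD hℓw

/-- ★ **The support of a SHARP Grössencharakter modulus is `c`-stable.**  Under the v43 prefix binders of S4‴ (`[K:ℚ] = 2` totally complex, `σK`,
`𝔪 ≠ 0`, `ψ` a Grössencharakter mod `𝔪` of type `(σK, 0)` with the trivial-Nebentypus clause) and the SHARPNESS export (prim′) of producer′
(`supp 𝔪 = ram χ` for every idelic realisation `χ` of `ψ`), for every `c : K ≃ₐ[ℚ] K` and every prime `w`: `𝔪 ≤ (c • w) ↔ 𝔪 ≤ w`.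
Proof: for `c ≠ 1`, the realisation `ω = heckeOfGross` satisfies `ω ∘ c = \bar ω` (both realise `w ↦ ψ(c • w) = \overline{ψ(w)}` almost everywhere;
multiplicity one), so `ram ω` is `c`-stable; then (prim′). [cite: Weil1956, §1] [cite: CasselsFrohlichANT1967, Ch. VII §4 Prop. 4.1] -/
theorem le_smul_asIdeal_iff_of_sharp [IsTotallyComplex K] (hK2 : Module.finrank ℚ K = 2) (σK : K →+* ℂ) (c : K ≃ₐ[ℚ] K)
    {𝔪 : Ideal (𝓞 K)} (h𝔪 : 𝔪 ≠ ⊥) {ψ : HeightOneSpectrum (𝓞 K) → ℂ} (hψ : IsGrossencharakter 𝔪 (embType σK) (embTypeConj σK) ψ)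
    (hψpow : ∀ n : ℕ, Odd n → n.Coprime ((NumberField.discr K).natAbs * Ideal.absNorm 𝔪) →
      idealPow K ψ (Ideal.span {(n : 𝓞 K)}) = (jacobiSym (NumberField.discr K) n : ℂ) * (n : ℂ) ^ (2 - 1))
    (hsharp : ∀ χ : HeckeCharacter K, (∀ᶠ v in cofinite, χ.valueAtUniformizer v = ψ v) →
      ∀ w : HeightOneSpectrum (𝓞 K), 𝔪 ≤ w.asIdeal ↔ ¬ χ.IsUnramifiedAt w)
    (w : HeightOneSpectrum (𝓞 K)) : 𝔪 ≤ (c • w).asIdeal ↔ 𝔪 ≤ w.asIdeal := by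
  by_cases hc : c = 1
  · rw [hc, one_smul]
  -- the realisation `ω` and its two conjugates
  set ω : HeckeCharacter K := heckeOfGross h𝔪 hψ with hωdef
  have hinf : ω.HasInfinityType (embType σK) (embTypeConj σK) := heckeOfGross_hasInfinityType h𝔪 hψ
  have hωreal : ∀ᶠ v : HeightOneSpectrum (𝓞 K) in cofinite, ω.valueAtUniformizer v = ψ v := by
    filter_upwards [eventually_not_le_asIdeal' h𝔪] with v hv
    exact heckeOfGross_valueAtUniformizer h𝔪 hψ hv
  set ωc : HeckeCharacter K := HeckeCharacter.galConj c ω with hωc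
  set ωb : HeckeCharacter K := hinf.autConj (Complex.conjAe.restrictScalars ℚ) with hωb
  -- they agree at almost every uniformiser
  have heq : ωc = ωb := by
    refine HeckeCharacter.ext_of_eventually_valueAtUniformizer_eq ?_
    filter_upwards [eventually_not_le_asIdeal' h𝔪, eventually_not_le_smul_asIdeal h𝔪 c,
      eventually_apply_smul_eq_conj hK2 σK c hc h𝔪 hψ hψpow] with v hv hcv hreal
    rw [hωc, HeckeCharacter.valueAtUniformizer_galConj_of_isUnramifiedAt c ω v (heckeOfGross_isUnramifiedAt h𝔪 hψ hcv),
      heckeOfGross_valueAtUniformizer h𝔪 hψ hcv, hreal, hωb, hinf.valueAtUniformizer_autConj, restrictScalars_conjAe_apply,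
      heckeOfGross_valueAtUniformizer h𝔪 hψ hv]
  -- so `ram ω` is `c`-stable
  have hram : ω.IsUnramifiedAt (c • w) ↔ ω.IsUnramifiedAt w := by
    rw [← HeckeCharacter.isUnramifiedAt_galConj_iff c ω w, ← hωc, heq, hωb, hinf.isUnramifiedAt_autConj_iff]
  rw [hsharp ω hωreal (c • w), hsharp ω hωreal w, hram]

end Symm

end Summit.BirchSwinnertonDyer.BirchSwinnertonDyer.Theorems.SmallImageLambdaLowerThreeNsThetaPartner

end
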